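import Literature.IUT.HodgeTheaters.FPrimeStrips
import HarnessLib

/-!
# [IUTchI] Corollary 5.3 (ii)–(iv): reduction to the model case, consistency, independence — proof-only companion of `FPrimeStrips`

Mochizuki, *Inter-universal Teichmüller theory I*, kurims manuscript (May 2020), §5, Corollary 5.3
"Isomorphisms of Global Frobenioids, Frobenioid-Prime-Strips, and Tempered Frobenioids" (ii),
p. 144: *"For `i = 1, 2`, let `ⁱ𝔉` be an `ℱ`-prime-strip; `ⁱ𝔇` the `𝒟`-prime-strip associated to `ⁱ𝔉`
[cf. Remark 5.2.1, (i)].  Then the natural map `Isom(¹𝔉, ²𝔉) → Isom(¹𝔇, ²𝔇)` [cf. Remark 5.2.1, (i)]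
is bijective"*; proof p. 144: *"Assertion (ii) (respectively, (iii)) follows immediately from
[AbsTopIII], Proposition 3.2, (iv); [AbsTopIII], Proposition 4.2, (i) [cf. also [AbsTopIII], Remarks
3.1.1, 4.1.1; the discussion of Definition 5.2, (vi), (viii), of the present paper] (respectively,
[AbsTopIII], Proposition 5.8, (ii), (v))"* (quotation corrected per referee pass G20-F1: an earlier
revision conflated this bracket with the citation "[FrdII], Definition 2.1, (ii)" of p. 145)
([IUTchI] Cor 5.3 (ii) p.144) [claim: Mochizuki2012, status: disputed].  Node `IUTchI:Cor5.3(ii)`;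
statement = the named `Prop` `PMBaseKit.FKit.IsomFtoDBijective` of `FPrimeStrips.lean`
(seat abc-iut-L5-t4), over the Frobenioid-level interface `FKit`.

WHAT IS PROVED (no anabelian input asserted).  Over the interface, an `ℱ`-prime-strip is a family of
isomorphs `‡ℱ_v ≅ ℱ_v` of the MODEL data and `𝔉 ↦ 𝔇` is the family of functors `toD v` (Rmk 5.2.1 (i)),
so the content of Cor 5.3 (ii) splits into (a) the statement for the model objects — for each `v`,
`Isom(ℱ_v, ℱ_v) → Isom(𝒟_v, 𝒟_v)`, `α ↦ 𝒟(α)`, is bijective — which is where [AbsTopIII] Prop. 3.2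
(iv) / 4.2 (i) enter (prerequisite layer L4; NOT asserted here), and (b) the passage from the models to
arbitrary isomorphs and to whole strips, which is functoriality and is PROVED here:
`isomFtoDBijective_iff_model : IsomFtoDBijective ↔ ∀ v, Bijective (α ↦ (toD v).mapIso α)` (both
directions: `isomFtoDBijective_of_model`, `model_bijective_of_isomFtoDBijective`), with the
conjugation lemma `mapIso_bijective_of_model` and the stronger sufficient form
`isomFtoDBijective_of_fullyFaithful`; and for Cor 5.3 (iv) (`AutTemperedBijective`, `v ∈ 𝕍^bad`)
the factorisation `Aut(ℱ̲_v) → Aut(ℱ_v) → Aut(𝒟_v)` through the tautological `ℱ`-prime-strip datum: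
`autTemperedBijective_of_layers` (bijective if the first map is and the model case of (ii) holds —
both hypotheses).  [Cor 5.3 (i), (iii) are typed over opaque maps `baseMap`, `toDmMap` of the kits
and admit no such reduction.]

CONSISTENCY / INDEPENDENCE (section `Witness`): kernel inhabitants of the interface, built inside
the proofs from abc-iut-L5-t4's `toyKit` / `MultKit.toy` / `FKit.toy`, for which each of the three
named statements `IsomFtoDBijective` (ii), `IsomFmtoDmSurjective` (iii), `AutTemperedBijective` (iv)
HOLDS (`…_toy`, resp. the first conjunct of `exists_fkit_autTemperedBijective_indep`) and others for
which it FAILS (`exists_fkit_not_…`): the statements are satisfiable as typed and are not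
consequences of the kit axioms (they carry exactly the content the print attributes to
[AbsTopIII] / [EtTh]).  Also landed separately (Mathlib-only): the classical input of the proof of
(iv), p. 145 — torsion-supported divisors have principal multiples —
`Literature/NumberTheory/EllipticCurves/TorsionDivisorsPrincipal.lean`.
No new definitions; no side taken on [IUTchIII] Cor. 3.12; typed ≠ discharged for the model case (a).
-/

namespace Literature.IUT.HodgeTheaters

open CategoryTheory

universe u

namespace PMBaseKit

namespace FKit

variable {l : ℕ} {K : PMBaseKit.{u} l} {M : K.MultKit} {FK : K.FKit M}

/-- Conjugating by isomorphisms to the models: if the natural map `Isom(ℱ_v, ℱ_v) → Isom(𝒟_v, 𝒟_v)`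
on the MODEL objects, `α ↦ (toD v)(α)`, is bijective, then so is `Isom(X, Y) → Isom(𝒟(X), 𝒟(Y))` for
any isomorphs `X ≅ ℱ_v`, `Y ≅ ℱ_v` (functoriality of `𝔉 ↦ 𝔇`, Rmk 5.2.1 (i)).
([IUTchI] Cor 5.3 (ii) p.144) [claim: Mochizuki2012, status: disputed] -/
theorem mapIso_bijective_of_model (v : K.V)
    (h : Function.Bijective fun α : FK.fModel v ≅ FK.fModel v => (FK.toD v).mapIso α)
    {X Y : FK.FAmb v} (eX : X ≅ FK.fModel v) (eY : Y ≅ FK.fModel v) :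
    Function.Bijective fun φ : X ≅ Y => (FK.toD v).mapIso φ := by
  have key : ∀ φ : X ≅ Y, eX ≪≫ (eX.symm ≪≫ φ ≪≫ eY) ≪≫ eY.symm = φ := fun φ => by
    ext; simp
  constructor
  · intro φ₁ φ₂ hφ
    have h' : (FK.toD v).mapIso (eX.symm ≪≫ φ₁ ≪≫ eY) = (FK.toD v).mapIso (eX.symm ≪≫ φ₂ ≪≫ eY) := by
      have hφ' : (FK.toD v).mapIso φ₁ = (FK.toD v).mapIso φ₂ := hφ
      simp only [Functor.mapIso_trans, hφ']
    have h2 := h.1 h'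
    rw [← key φ₁, ← key φ₂]
    exact congrArg (fun β => eX ≪≫ β ≪≫ eY.symm) h2
  · intro ψ
    obtain ⟨α, hα⟩ := h.2 (((FK.toD v).mapIso eX).symm ≪≫ ψ ≪≫ (FK.toD v).mapIso eY)
    refine ⟨eX ≪≫ α ≪≫ eY.symm, ?_⟩
    have hα' : (FK.toD v).mapIso α = ((FK.toD v).mapIso eX).symm ≪≫ ψ ≪≫ (FK.toD v).mapIso eY := hα
    show (FK.toD v).mapIso (eX ≪≫ α ≪≫ eY.symm) = ψ
    simp only [Functor.mapIso_trans, Functor.mapIso_symm, hα']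
    ext; simp

/-- **Cor 5.3 (ii) from its model case.**  If for every `v ∈ 𝕍` the natural map
`Isom(ℱ_v, ℱ_v) → Isom(𝒟_v, 𝒟_v)` on the MODEL data of Def 5.2 (i) is bijective, then for all
`ℱ`-prime-strips `¹𝔉, ²𝔉` the natural map `Isom(¹𝔉, ²𝔉) → Isom(¹𝔇, ²𝔇)` is bijective — i.e. the named
statement `IsomFtoDBijective` holds.  (The model case is where the anabelian input [AbsTopIII]
Prop. 3.2 (iv), 4.2 (i) enters; the passage to arbitrary isomorphs is the functoriality of
`𝔉 ↦ 𝔇`, Rmk 5.2.1 (i).) ([IUTchI] Cor 5.3 (ii) p.144) [claim: Mochizuki2012, status: disputed] -/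
theorem isomFtoDBijective_of_model
    (h : ∀ v, Function.Bijective fun α : FK.fModel v ≅ FK.fModel v => (FK.toD v).mapIso α) :
    FK.IsomFtoDBijective := by
  intro F₁ F₂
  have hv : ∀ v, Function.Bijective fun φ : F₁.obj v ≅ F₂.obj v => (FK.toD v).mapIso φ :=
    fun v => mapIso_bijective_of_model v (h v) (F₁.isModel v).some (F₂.isModel v).some
  constructor
  · intro φ₁ φ₂ hφ
    funext v
    exact (hv v).1 (congrFun hφ v)
  · intro ψ
    choose φ hφ using fun v => (hv v).2 (ψ v)
    exact ⟨φ, funext hφ⟩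

/-- **The model case from Cor 5.3 (ii)**: conversely, `IsomFtoDBijective` applied to the model
`ℱ`-prime-strip `{ℱ_v}_{v∈𝕍}` gives, at each `v`, the bijectivity of `Isom(ℱ_v, ℱ_v) → Isom(𝒟_v, 𝒟_v)`
(extend an isomorphism at `v` by identities at `w ≠ v`).
([IUTchI] Cor 5.3 (ii) p.144) [claim: Mochizuki2012, status: disputed] -/
theorem model_bijective_of_isomFtoDBijective (h : FK.IsomFtoDBijective) (v : K.V) :
    Function.Bijective fun α : FK.fModel v ≅ FK.fModel v => (FK.toD v).mapIso α := by
  classical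
  let F₀ : FK.FStrip := ⟨FK.fModel, fun w => ⟨Iso.refl _⟩⟩
  have hb := h F₀ F₀
  -- extension by identities
  let ext : (FK.fModel v ≅ FK.fModel v) → F₀.Iso F₀ := fun α =>
    Function.update (fun w => Iso.refl (FK.fModel w)) v α
  have ext_v : ∀ α, ext α v = α := fun α => by simp [ext]
  have ext_ne : ∀ α w, w ≠ v → ext α w = Iso.refl _ := fun α w hw =>
    Function.update_of_ne hw _ _
  constructor
  · intro α₁ α₂ hα
    have hα' : (FK.toD v).mapIso α₁ = (FK.toD v).mapIso α₂ := hα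
    have hext : FStrip.assocDMap (ext α₁) = FStrip.assocDMap (ext α₂) := by
      funext w
      by_cases hw : w = v
      · subst hw
        show (FK.toD w).mapIso (ext α₁ w) = (FK.toD w).mapIso (ext α₂ w)
        rw [ext_v, ext_v, hα']
      · show (FK.toD w).mapIso (ext α₁ w) = (FK.toD w).mapIso (ext α₂ w)
        rw [ext_ne α₁ w hw, ext_ne α₂ w hw]
    have := congrFun (hb.1 hext) v
    rwa [ext_v, ext_v] at this
  · intro ψ
    let Ψ : F₀.assocD.Iso F₀.assocD :=
      Function.update (fun w => Iso.refl (F₀.assocD.obj w)) v ψ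
    obtain ⟨φ, hφ⟩ := hb.2 Ψ
    refine ⟨φ v, ?_⟩
    have := congrFun hφ v
    show (FK.toD v).mapIso (φ v) = ψ
    have hΨ : Ψ v = ψ := by simp [Ψ]
    rw [← hΨ]
    exact this

/-- **Cor 5.3 (ii) is EQUIVALENT to its model case**: the natural maps `Isom(¹𝔉, ²𝔉) → Isom(¹𝔇, ²𝔇)`
are bijective for all `ℱ`-prime-strips iff, for each `v ∈ 𝕍`, `Isom(ℱ_v, ℱ_v) → Isom(𝒟_v, 𝒟_v)` is
bijective on the model data of Examples 3.2 (iii) / 3.3 (i) / 3.4 (i) — which isolates exactly what the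
anabelian input of the printed proof ("follows from [AbsTopIII], Proposition 3.2, (iv); 4.2, (i)")
must supply. ([IUTchI] Cor 5.3 (ii) p.144) [claim: Mochizuki2012, status: disputed] -/
theorem isomFtoDBijective_iff_model :
    FK.IsomFtoDBijective ↔
      ∀ v, Function.Bijective fun α : FK.fModel v ≅ FK.fModel v => (FK.toD v).mapIso α :=
  ⟨model_bijective_of_isomFtoDBijective, isomFtoDBijective_of_model⟩

/-- A sufficient (stronger) form: if each functor `ℱ_v ↦ 𝒟_v` of Rmk 5.2.1 (i) is fully faithful,
Cor 5.3 (ii) holds (cf. the use made of Cor 5.3 (ii) in `PolyIso.map_full_of_fullyFaithful`).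
([IUTchI] Cor 5.3 (ii) p.144) [claim: Mochizuki2012, status: disputed] -/
theorem isomFtoDBijective_of_fullyFaithful (h : ∀ v, (FK.toD v).FullyFaithful) :
    FK.IsomFtoDBijective :=
  isomFtoDBijective_of_model fun v => (h v).isoEquiv.bijective

/-- **Cor 5.3 (iv) from its two layers.**  `Aut(ℱ̲_v) → Aut(𝒟_v)` (the named statement
`AutTemperedBijective`, `v ∈ 𝕍^bad`) factors as `Aut(ℱ̲_v) → Aut(ℱ_v) → Aut(𝒟(ℱ_v))` through the
`ℱ`-prime-strip datum `ℱ_v` of the tempered Frobenioid (the functor `thToF v`, "the `ℱ`-prime-strip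
tautologically associated", p. 147); so it is bijective as soon as the first map is bijective on the
model and the model case of Cor 5.3 (ii) holds at `v` (transported along `thToF_model v : ℱ(ℱ̲_v) ≅ ℱ_v`).
Both inputs are hypotheses ([EtTh] cyclotomic rigidity / [FrdI] Thm 5.2, Prop 5.6 for the first;
[AbsTopIII] for the second), never asserted. ([IUTchI] Cor 5.3 (iv) p.144) [claim: Mochizuki2012, status: disputed] -/
theorem autTemperedBijective_of_layers
    (h₁ : ∀ v ∈ K.bad, Function.Bijective fun α : FK.thModel v ≅ FK.thModel v => (FK.thToF v).mapIso α)
    (h₂ : ∀ v ∈ K.bad, Function.Bijective fun α : FK.fModel v ≅ FK.fModel v => (FK.toD v).mapIso α) :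
    FK.AutTemperedBijective := by
  intro v hv
  have h₂' := mapIso_bijective_of_model v (h₂ v hv) (FK.thToF_model v) (FK.thToF_model v)
  have hcomp : (fun α : Aut (FK.thModel v) => (FK.thToF v ⋙ FK.toD v).mapIso α) =
      (fun φ : (FK.thToF v).obj (FK.thModel v) ≅ (FK.thToF v).obj (FK.thModel v) =>
        (FK.toD v).mapIso φ) ∘ (fun α : FK.thModel v ≅ FK.thModel v => (FK.thToF v).mapIso α) := by
    funext α
    exact Iso.ext rfl
  rw [hcomp]
  exact h₂'.comp (h₁ v hv)


/-! ### Consistency and independence of the named rigidity statements over the toy kits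

The three named `Prop`s of Cor 5.3 (ii)–(iv) are typed over the interface `FKit`; the following
kernel witnesses certify that (a) each HOLDS for an honest inhabitant of the interface (consistency:
the statements are satisfiable exactly as typed) and (b) each FAILS for another inhabitant
(independence: the statements are not consequences of the interface axioms, i.e. they carry content —
the content the printed proof attributes to [AbsTopIII] Prop. 3.2 (iv), 4.2 (i), 5.8 (ii), (v) and
[EtTh]).  No new definitions: the inhabitants are built inside the proofs from abc-iut-L5-t4's
`PMBaseKit.toyKit` / `MultKit.toy` / `FKit.toy`. -/

section Witness

variable (l : ℕ) [Fact l.Prime] (hl : l ≠ 2)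

/-- CONSISTENCY of Cor 5.3 (ii) as typed: `IsomFtoDBijective` holds for the toy kit `FKit.toy`
(there `ℱ_v ↦ 𝒟_v` is the identity functor, fully faithful).
([IUTchI] Cor 5.3 (ii) p.144) [claim: Mochizuki2012, status: disputed] -/
theorem isomFtoDBijective_toy : (FKit.toy l hl).IsomFtoDBijective :=
  isomFtoDBijective_of_fullyFaithful fun _ => Functor.FullyFaithful.id _

/-- INDEPENDENCE of Cor 5.3 (ii) from the interface axioms: over the same base kit there is an
`FKit` (one rigid object `ℱ_v` lying over the model `𝒟_v`, which has the automorphism `−1`) for which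
`IsomFtoDBijective` FAILS — so the named statement is not provable from the kit axioms alone.
([IUTchI] Cor 5.3 (ii) p.144) [claim: Mochizuki2012, status: disputed] -/
theorem exists_fkit_not_isomFtoDBijective :
    ∃ FK : (toyKit l hl).FKit (MultKit.toy l hl), ¬ FK.IsomFtoDBijective := by
  classical
  refine ⟨{ FAmb := fun _ => Discrete PUnit.{1}
            fModel := fun _ => ⟨⟨⟩⟩
            FmAmb := (FKit.toy l hl).FmAmb
            fmModel := (FKit.toy l hl).fmModel
            toD := fun _ => (Functor.const _).obj Model.Obj.loc
            toD_model := fun _ => Iso.refl _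
            toFm := fun _ => (Functor.const _).obj Model.Obj.loc
            toFm_model := fun _ => Iso.refl _
            RlfAmb := (FKit.toy l hl).RlfAmb
            rlfModel := (FKit.toy l hl).rlfModel
            rlfFm := (FKit.toy l hl).rlfFm
            rlfOf := fun _ _ => Model.Obj.loc
            rlfOfMap := fun _ => Iso.refl _
            rlfFm_rlfOf := fun _ _ => Iso.refl _
            ThAmb := fun _ => Discrete PUnit.{1}
            thModel := fun _ => ⟨⟨⟩⟩
            thToF := fun _ => 𝟭 _
            thToF_model := fun _ => Iso.refl _
            toDm := fun _ => SingleObj.star _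
            toDmMap := fun _ => 𝟙 _
            toDm_toFm := fun _ _ => ⟨𝟙 _⟩ }, fun h => ?_⟩
  have hb := model_bijective_of_isomFtoDBijective h ()
  obtain ⟨α, hα⟩ := hb.2
    ⟨(-1 : ℤˣ), (-1 : ℤˣ), by change (-1 : ℤˣ) * (-1) = 1; simp, by change (-1 : ℤˣ) * (-1) = 1; simp⟩
  have h1 : (1 : ℤˣ) = -1 := congrArg Iso.hom hα
  exact absurd (congrArg Units.val h1) (by norm_num)

/-- CONSISTENCY of Cor 5.3 (iii) as typed: `IsomFmtoDmSurjective` holds for the toy kit (whose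
category of `𝒟^⊢`-prime-strips has a single morphism).
([IUTchI] Cor 5.3 (iii) p.144) [claim: Mochizuki2012, status: disputed] -/
theorem isomFmtoDmSurjective_toy : (FKit.toy l hl).IsomFmtoDmSurjective := by
  intro F₁ F₂ ψ
  refine ⟨fun v => (F₁.isModel v).some ≪≫ (F₂.isModel v).some.symm, ?_⟩
  rcases ψ with ⟨⟩
  rfl

/-- INDEPENDENCE of Cor 5.3 (iii) from the interface axioms: over the toy base kit there are a
`MultKit` (one `𝒟^⊢`-prime-strip with automorphism group `ℤ/2`) and an `FKit` (mono-analyticization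
constant on isomorphisms) for which `IsomFmtoDmSurjective` FAILS.
([IUTchI] Cor 5.3 (iii) p.144) [claim: Mochizuki2012, status: disputed] -/
theorem exists_fkit_not_isomFmtoDmSurjective :
    ∃ (M : (toyKit l hl).MultKit) (FK : (toyKit l hl).FKit M), ¬ FK.IsomFmtoDmSurjective := by
  classical
  let M : (toyKit l hl).MultKit :=
    { DMono := SingleObj (Multiplicative (ZMod 2))
      mono := fun _ => SingleObj.star _
      monoMap := fun _ => 𝟙 _
      thetaPolyBad := fun _ _ _ => ∅ }
  let FK : (toyKit l hl).FKit M :=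
    { FAmb := (FKit.toy l hl).FAmb
      fModel := (FKit.toy l hl).fModel
      FmAmb := (FKit.toy l hl).FmAmb
      fmModel := (FKit.toy l hl).fmModel
      toD := (FKit.toy l hl).toD
      toD_model := (FKit.toy l hl).toD_model
      toFm := (FKit.toy l hl).toFm
      toFm_model := (FKit.toy l hl).toFm_model
      RlfAmb := (FKit.toy l hl).RlfAmb
      rlfModel := (FKit.toy l hl).rlfModel
      rlfFm := (FKit.toy l hl).rlfFm
      rlfOf := (FKit.toy l hl).rlfOf
      rlfOfMap := (FKit.toy l hl).rlfOfMap
      rlfFm_rlfOf := (FKit.toy l hl).rlfFm_rlfOf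
      ThAmb := (FKit.toy l hl).ThAmb
      thModel := (FKit.toy l hl).thModel
      thToF := (FKit.toy l hl).thToF
      thToF_model := (FKit.toy l hl).thToF_model
      toDm := fun _ => SingleObj.star _
      toDmMap := fun _ => 𝟙 _
      toDm_toFm := fun _ _ => ⟨𝟙 _⟩ }
  refine ⟨M, FK, fun h => ?_⟩
  let F₀ : FK.FmStrip := ⟨(FKit.toy l hl).fmModel, fun _ => ⟨Iso.refl _⟩⟩
  obtain ⟨φ, hφ⟩ := h F₀ F₀ (Multiplicative.ofAdd (1 : ZMod 2))
  have h1 : (1 : Multiplicative (ZMod 2)) = Multiplicative.ofAdd (1 : ZMod 2) := hφ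
  exact absurd h1 (by decide)

include hl in
/-- CONSISTENCY and INDEPENDENCE of Cor 5.3 (iv) as typed (`AutTemperedBijective`, quantified over
`v ∈ 𝕍^bad`; the toy base kit has `𝕍^bad = ∅`, so the witnesses live over its variant with
`𝕍^bad = {the unique place}` — written without the kit's `Fintype 𝕍` field so that the planned
Fintype-free successor kit (merge-map B11) keeps this witness): there are a base kit with
`𝕍^bad ≠ ∅`, a `MultKit` over it, and two `FKit`s over them,
for one of which `AutTemperedBijective` HOLDS (all of `ℱ̲_v ↦ ℱ_v ↦ 𝒟_v` identity functors) and for the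
other FAILS (a rigid `ℱ̲_v` over the model `𝒟_v` with its automorphism `−1`).
([IUTchI] Cor 5.3 (iv) p.144) [claim: Mochizuki2012, status: disputed] -/
theorem exists_fkit_autTemperedBijective_indep :
    ∃ (K : PMBaseKit.{0} l) (M : K.MultKit), K.bad.Nonempty ∧
      (∃ FK : K.FKit M, FK.AutTemperedBijective) ∧ (∃ FK : K.FKit M, ¬ FK.AutTemperedBijective) := by
  classical
  refine ⟨{ toyKit l hl with bad := ({()} : Finset Unit) },
    { DMono := SingleObj Unit
      mono := fun _ => SingleObj.star _
      monoMap := fun _ => 𝟙 _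
      thetaPolyBad := fun _ _ _ => ∅ }, ⟨(), Finset.mem_singleton_self _⟩, ?_, ?_⟩
  · refine ⟨{ FAmb := fun _ => Model.Obj l
              fModel := fun _ => Model.Obj.loc
              FmAmb := fun _ => Model.Obj l
              fmModel := fun _ => Model.Obj.loc
              toD := fun _ => 𝟭 _
              toD_model := fun _ => Iso.refl _
              toFm := fun _ => 𝟭 _
              toFm_model := fun _ => Iso.refl _
              RlfAmb := ∀ _ : Unit, Model.Obj l
              rlfModel := fun _ => Model.Obj.loc
              rlfFm := fun v => Pi.eval _ v
              rlfOf := fun F => F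
              rlfOfMap := fun φ => Pi.isoMk φ
              rlfFm_rlfOf := fun _ _ => Iso.refl _
              ThAmb := fun _ => Model.Obj l
              thModel := fun _ => Model.Obj.loc
              thToF := fun _ => 𝟭 _
              thToF_model := fun _ => Iso.refl _
              toDm := fun _ => SingleObj.star _
              toDmMap := fun _ => 𝟙 _
              toDm_toFm := fun _ _ => ⟨𝟙 _⟩ }, fun v _ => ?_⟩
    exact ((Functor.FullyFaithful.id _).comp (Functor.FullyFaithful.id _)).isoEquiv.bijective
  · refine ⟨{ FAmb := fun _ => Discrete PUnit.{1}
              fModel := fun _ => ⟨⟨⟩⟩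
              FmAmb := fun _ => Model.Obj l
              fmModel := fun _ => Model.Obj.loc
              toD := fun _ => (Functor.const _).obj Model.Obj.loc
              toD_model := fun _ => Iso.refl _
              toFm := fun _ => (Functor.const _).obj Model.Obj.loc
              toFm_model := fun _ => Iso.refl _
              RlfAmb := ∀ _ : Unit, Model.Obj l
              rlfModel := fun _ => Model.Obj.loc
              rlfFm := fun v => Pi.eval _ v
              rlfOf := fun _ _ => Model.Obj.loc
              rlfOfMap := fun _ => Iso.refl _
              rlfFm_rlfOf := fun _ _ => Iso.refl _
              ThAmb := fun _ => Discrete PUnit.{1}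
              thModel := fun _ => ⟨⟨⟩⟩
              thToF := fun _ => 𝟭 _
              thToF_model := fun _ => Iso.refl _
              toDm := fun _ => SingleObj.star _
              toDmMap := fun _ => 𝟙 _
              toDm_toFm := fun _ _ => ⟨𝟙 _⟩ }, fun h => ?_⟩
    obtain ⟨α, hα⟩ := (h () (Finset.mem_singleton_self _)).2
      ⟨(-1 : ℤˣ), (-1 : ℤˣ), by change (-1 : ℤˣ) * (-1) = 1; simp, by change (-1 : ℤˣ) * (-1) = 1; simp⟩
    have h1 : (1 : ℤˣ) = -1 := congrArg Iso.hom hα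
    exact absurd (congrArg Units.val h1) (by norm_num)

end Witness

/-! ### Remark 5.2.1 (ii): the `ℱ^⊢`-prime-strip inside `‡𝔉^⊩` (appended) -/

/-- The hypothesis `h` of `FrStrip.fmStrip` ("the interface functor `rlfFm v` carries the model
`𝔉^⊩_mod` to an isomorph of the model `ℱ^⊢_v`") is NOT independent data: it follows from the printed
claim of Rmk 5.2.1 (ii) (`RlfOfIsStrip`: `‡𝔉 ↦ ‡𝔉^⊩` lands in `ℱ^⊩`-prime-strips) applied to the model
strip, composed with the kit isomorphisms `rlfFm_rlfOf` and `toFm_model` (reviewer note (b) on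
p408717 made precise). ([IUTchI] Rmk 5.2.1 (ii) p.143) [claim: Mochizuki2012, status: disputed] -/
theorem nonempty_rlfFm_rlfModel_iso_of_rlfOfIsStrip (h : FK.RlfOfIsStrip) (v : K.V) :
    Nonempty ((FK.rlfFm v).obj FK.rlfModel ≅ FK.fmModel v) := by
  let F₀ : FK.FStrip := ⟨FK.fModel, fun w => ⟨Iso.refl _⟩⟩
  obtain ⟨e⟩ := h F₀
  exact ⟨(FK.rlfFm v).mapIso e.symm ≪≫ FK.rlfFm_rlfOf FK.fModel v ≪≫ FK.toFm_model v⟩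

/-- Hence, under Rmk 5.2.1 (ii), every `ℱ^⊩`-prime-strip has its `ℱ^⊢`-prime-strip [datum (d) of
Def 5.2 (iv)] with no extra hypothesis: the `v`-components are isomorphs of the models `ℱ^⊢_v`.
([IUTchI] Def 5.2 (iv) p.135) [claim: Mochizuki2012, status: disputed] -/
theorem nonempty_rlfFm_iso_fmModel_of_rlfOfIsStrip (h : FK.RlfOfIsStrip) (F : FK.FrStrip) (v : K.V) :
    Nonempty ((FK.rlfFm v).obj F.obj ≅ FK.fmModel v) :=
  ⟨(FK.rlfFm v).mapIso F.isModel.some ≪≫ (nonempty_rlfFm_rlfModel_iso_of_rlfOfIsStrip h v).some⟩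

/-- CONSISTENCY of Rmk 5.2.1 (ii) as typed: `RlfOfIsStrip` ("`‡𝔉 ↦ ‡𝔉^⊩` forms an
`ℱ^⊩`-prime-strip") holds for the toy kit (`rlfOf = id` on the product category).
([IUTchI] Rmk 5.2.1 (ii) p.143) [claim: Mochizuki2012, status: disputed] -/
theorem rlfOfIsStrip_toy (l : ℕ) [Fact l.Prime] (hl : l ≠ 2) : (FKit.toy l hl).RlfOfIsStrip :=
  fun F => ⟨Pi.isoMk fun v => (F.isModel v).some⟩

end FKit

end PMBaseKit

end Literature.IUT.HodgeTheaters
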